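import Summits.QuantumFields.QCD.Theses.SpectralDefectExtinction
import Summits.QuantumFields.QCD.Theorems.ExtinctionBuildsQCD.Negative.WithoutTightCollapse
import Summits.QuantumFields.QCD.Theorems.ExtinctionBuildsQCD.Negative.ExtinctIntegrable
import Literature.MathematicalPhysics.QuantumFieldTheory.QCDPhaseQuenchedReweighting
import Literature.MathematicalPhysics.QuantumLattice.WilsonPositivityDomain

/-!
# Stub `stub_schemeVolumeTransfer` of line `dilution-buys-local-rarity`
(crux `Summit.QuantumFields.QCD.Theses.SpectralDefectExtinction.ExtinctionBuildsQCD`, item stmt-QuantumFields-8968)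

**The exchange identity made exact: honest = clean + o(1) at the scheme's own side, NO extinction
rate.** Along a regularisation satisfying EXTINCT, the honest lattice Schwinger function (a quotient of
two signed gauge integrals at the scheme's side `2L_k+1`) has the same limit as the quotient of the same
two integrals restricted to the clean event `{defect count = 0}`, as soon as the defective part of the
numerator is `O(∫ N_k |det D| dμ_W)`. Route: `det D_W(U, m_f(k), 1) > 0` on the clean event
(`fermionDet_re_pos_of_clean`: no zero of the real continuous `t ↦ det D_W(U,t,1)` on `[m_f(k), ∞)`,
Seiler positivity `fermionDet_wilsonDirac_re_pos`, intermediate value theorem), so `det D = |det D|`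
there (`det_diracMatrix_eq_norm_of_clean`); the defective signed mass is `≤ ∫N|det D|`, the clean mass
is `≥ ∫|det D| − ∫N|det D|` (`clean_mass_bounds`); quotient algebra (`norm_ratio_sub_cleanRatio_le`);
EXTINCT at `S = L_k`, volume factor `1` (`eventually_defectMass_le`); assembly `tendsto_ratio_of_rareDefects`.
-/

noncomputable section

open scoped BigOperators Topology SchwartzMap
open MeasureTheory Filter
open Literature.MathematicalPhysics.AQFT Literature.Probability.LatticeModels
  Literature.MathematicalPhysics.QuantumLattice Literature.MathematicalPhysics.QuantumFieldTheory
open Summit.QuantumFields.QCD.Theses.SpectralDefectExtinction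
-- buildfix 2026-08-19: `extinctionBuildsQCD_iff` dropped from the `open … (…)` list — it is unused here and is a dead decl
-- (Iff.rfl against the pre-rev-9 body of `ExtinctionBuildsQCD`) scheduled for maintenance removal from WithoutTightCollapse.
open Summit.QuantumFields.QCD.Theorems.ExtinctionBuildsQCD.Negative (Extinct Tight SDHyp
  measurable_signDefectCount measurable_coercivityDefectCount countP_roots_charpoly_le_card)

namespace Summit.QuantumFields.QCD.Cruxes.ExtinctionBuildsQCD.DilutionBuysLocalRarity

/-- A zero of `t ↦ det D_W(U, t, 1)` at `t` is a (real) root `−t` of the characteristic polynomial of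
the massless operator `D_W(U, 0, 1)` (`D_W(U,t,1) = D_W(U,0,1) + t·1`). -/
theorem neg_mem_roots_charpoly_of_det_eq_zero {L : ℕ} [NeZero L] (U : GaugeConfig 4 L SU3) {t : ℝ}
    (h : (wilsonDirac (fundamentalRep (Fin 3)) U t 1).det = 0) :
    ((-t : ℝ) : ℂ) ∈ (wilsonDirac (fundamentalRep (Fin 3)) U 0 1).charpoly.roots := by
  rw [Polynomial.mem_roots (Matrix.charpoly_monic _).ne_zero, Polynomial.IsRoot.def, Matrix.eval_charpoly]
  have hmat : Matrix.scalar _ (((-t : ℝ)) : ℂ) - wilsonDirac (fundamentalRep (Fin 3)) U 0 1 =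
      -(wilsonDirac (fundamentalRep (Fin 3)) U t 1) := by
    rw [wilsonDirac_mass_eq_add_scalar (fundamentalRep (Fin 3)) U t 1, Complex.ofReal_neg, map_neg]
    abel
  rw [hmat, Matrix.det_neg, h, mul_zero]

/-- **`det D_W(U, t₀, 1) > 0` on the clean event (per flavour).** For an `SU(3)` gauge field `U` on any
torus: if `D_W(U,0,1)` has no real eigenvalue below `−t₀` (no sign defect) and `Γ₅ D_W(U,t₀,1)` has no
eigenvalue of modulus `< w`, `w > 0` (no coercivity defect), then `Re det D_W(U,t₀,1) > 0` — the real
continuous `t ↦ det D_W(U,t,1)` has no zero on `[t₀, ∞)` and is positive for `t > 0` (Seiler); IVT. -/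
theorem fermionDet_re_pos_of_clean {L : ℕ} [NeZero L] (U : GaugeConfig 4 L SU3) {t₀ w : ℝ} (hw : 0 < w)
    (ha : Multiset.countP (fun z : ℂ => z.im = 0 ∧ z.re < -t₀)
      (wilsonDirac (fundamentalRep (Fin 3)) U 0 1).charpoly.roots = 0)
    (hb : Multiset.countP (fun z : ℂ => |z.re| < w)
      (spinorLift gammaFive * wilsonDirac (fundamentalRep (Fin 3)) U t₀ 1).charpoly.roots = 0) :
    0 < (fermionDet (wilsonDirac (fundamentalRep (Fin 3)) U t₀ 1)).re := by
  have hρ : ∀ g : SU3, fundamentalRep (Fin 3) g ∈ Matrix.unitaryGroup (Fin 3) ℂ := fundamentalRep_mem_unitaryGroup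
  -- no zero of the determinant on `[t₀, ∞)`
  have hne : ∀ t : ℝ, t₀ ≤ t → (wilsonDirac (fundamentalRep (Fin 3)) U t 1).det ≠ 0 := by
    intro t ht h0
    rcases ht.eq_or_lt with rfl | hlt
    · -- `t = t₀`: zero is an eigenvalue of `Γ₅ D_W(U,t₀,1)`
      refine (Multiset.countP_pos.2 ⟨0, ?_, by simpa using hw⟩).ne' hb
      rw [Polynomial.mem_roots (Matrix.charpoly_monic _).ne_zero, Polynomial.IsRoot.def,
        Matrix.eval_charpoly, map_zero, zero_sub, Matrix.det_neg, Matrix.det_mul, h0, mul_zero, mul_zero]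
    · -- `t > t₀`: `-t` is a real eigenvalue of `D_W(U,0,1)` below `-t₀`
      refine (Multiset.countP_pos.2
        ⟨((-t : ℝ) : ℂ), neg_mem_roots_charpoly_of_det_eq_zero U h0, ?_⟩).ne' ha
      exact ⟨Complex.ofReal_im _, by rw [Complex.ofReal_re]; linarith⟩
  -- the determinant as a real continuous function of the bare mass
  have him : ∀ t : ℝ, ((wilsonDirac (fundamentalRep (Fin 3)) U t 1).det).im = 0 := fun t =>
    fermionDet_wilsonDirac_im_holds (L := L) (fundamentalRep (Fin 3)) hρ U t 1
  set g : ℝ → ℝ := fun t => ((wilsonDirac (fundamentalRep (Fin 3)) U t 1).det).re with hgdef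
  have hg_eq : ∀ t, (wilsonDirac (fundamentalRep (Fin 3)) U t 1).det = ((g t : ℝ) : ℂ) := fun t =>
    Complex.ext (by simp [hgdef]) (by simp [him t])
  have hg_cont : Continuous g := by
    have h1 : Continuous fun t : ℝ =>
        wilsonDirac (fundamentalRep (Fin 3)) U 0 1 + Matrix.scalar _ ((t : ℝ) : ℂ) := by
      refine continuous_const.add ?_
      simp_rw [Matrix.scalar_apply]
      exact (continuous_pi fun _ => Complex.continuous_ofReal).matrix_diagonal
    have h2 : g = fun t : ℝ =>
        ((wilsonDirac (fundamentalRep (Fin 3)) U 0 1 + Matrix.scalar _ ((t : ℝ) : ℂ)).det).re := by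
      funext t; simp only [hgdef]; rw [wilsonDirac_mass_eq_add_scalar (fundamentalRep (Fin 3)) U t 1]
    exact h2 ▸ Complex.continuous_re.comp h1.matrix_det
  have hg_ne : ∀ t, t₀ ≤ t → g t ≠ 0 := fun t ht h0 =>
    hne t ht (by rw [hg_eq, h0, Complex.ofReal_zero])
  -- positive at the positive mass `|t₀| + 1` (Seiler), intermediate value theorem on `[t₀, |t₀| + 1]`
  have hT : 0 < g (|t₀| + 1) := fermionDet_wilsonDirac_re_pos (fundamentalRep (Fin 3)) hρ U (by positivity)
  have hle : t₀ ≤ |t₀| + 1 := (le_abs_self _).trans (le_add_of_nonneg_right zero_le_one)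
  by_contra hcon
  have hlt : g t₀ < 0 := lt_of_le_of_ne (not_lt.1 hcon) (hg_ne t₀ le_rfl)
  obtain ⟨s, hs, hs0⟩ := intermediate_value_Icc hle hg_cont.continuousOn ⟨hlt.le, hT.le⟩
  exact hg_ne s hs.1 hs0

/-- **On the clean event the `N_f`-flavour Wilson determinant equals its modulus.** If the defect
count of EXTINCT vanishes at `U` (step `k`, `c > 0`, positive renormalised masses), every flavour
determinant is a positive real (`fermionDet_re_pos_of_clean`, window `c a_k m_f/Z_k > 0`), so
`det (diracMatrix U m(k)) = ∏_f det D_W(U, m_f(k), 1) = |det (diracMatrix U m(k))|`. -/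
theorem det_diracMatrix_eq_norm_of_clean {Nf L : ℕ} [NeZero L] (reg : QCDRegularisation Nf) {c : ℝ}
    (hc : 0 < c) {m : Fin Nf → ℝ} (hm : ∀ fl, 0 < m fl) (k : ℕ) (U : GaugeConfig 4 L SU3)
    (hN : (∑ g : Fin Nf, (Multiset.countP (fun z : ℂ => z.im = 0 ∧ z.re < -(reg.mcrit k + reg.a k * m g / reg.Zm k)) (wilsonDirac (fundamentalRep (Fin 3)) U 0 1).charpoly.roots + Multiset.countP (fun z : ℂ => |z.re| < c * (reg.a k * m g / reg.Zm k)) (spinorLift gammaFive * wilsonDirac (fundamentalRep (Fin 3)) U (reg.mcrit k + reg.a k * m g / reg.Zm k) 1).charpoly.roots)) = 0) :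
    (diracMatrix U fun fl => reg.mcrit k + reg.a k * m fl / reg.Zm k).det =
      ↑‖(diracMatrix U fun fl => reg.mcrit k + reg.a k * m fl / reg.Zm k).det‖ := by
  have hρ : ∀ g : SU3, fundamentalRep (Fin 3) g ∈ Matrix.unitaryGroup (Fin 3) ℂ := fundamentalRep_mem_unitaryGroup
  have hpos : ∀ fl : Fin Nf,
      0 < (fermionDet (wilsonDirac (fundamentalRep (Fin 3)) U (reg.mcrit k + reg.a k * m fl / reg.Zm k) 1)).re := by
    intro fl
    obtain ⟨ha, hb⟩ := Nat.eq_zero_of_add_eq_zero ((Finset.sum_eq_zero_iff.1 hN) fl (Finset.mem_univ _))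
    exact fermionDet_re_pos_of_clean U
      (mul_pos hc (div_pos (mul_pos (reg.a_pos k) (hm fl)) (reg.Zm_pos k))) ha hb
  have hreal : ∀ fl : Fin Nf,
      fermionDet (wilsonDirac (fundamentalRep (Fin 3)) U (reg.mcrit k + reg.a k * m fl / reg.Zm k) 1) =
        (((fermionDet (wilsonDirac (fundamentalRep (Fin 3)) U
          (reg.mcrit k + reg.a k * m fl / reg.Zm k) 1)).re : ℝ) : ℂ) := fun fl =>
    Complex.ext (by simp) (by
      simpa using fermionDet_wilsonDirac_im_holds (L := L) (fundamentalRep (Fin 3)) hρ U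
        (reg.mcrit k + reg.a k * m fl / reg.Zm k) 1)
  rw [det_diracMatrix, Finset.prod_congr rfl fun fl _ => hreal fl, ← Complex.ofReal_prod, Complex.norm_real,
    Real.norm_of_nonneg (Finset.prod_nonneg fun fl _ => (hpos fl).le)]

/-- A bounded `ℕ`-valued measurable count times the phase-quenched weight `|det D(U)|` is integrable
against any finite measure on configurations. -/
theorem integrable_natCast_mul_norm_det {Nf L : ℕ} [NeZero L] (μ : Measure (GaugeConfig 4 L SU3))
    [IsFiniteMeasure μ] (mq : Fin Nf → ℝ) {Nn : GaugeConfig 4 L SU3 → ℕ} (hNm : Measurable Nn) {M : ℕ}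
    (hNb : ∀ U, Nn U ≤ M) :
    Integrable (fun U => (Nn U : ℝ) * ‖(diracMatrix U mq).det‖) μ := by
  obtain ⟨Cd, hCd⟩ := exists_norm_det_diracMatrix_le (S := L) mq
  refine Integrable.of_bound (((measurable_from_nat (f := (Nat.cast : ℕ → ℝ))).comp hNm).mul
    (continuous_det_diracMatrix mq).measurable.norm).aestronglyMeasurable ((M : ℝ) * Cd)
    (Eventually.of_forall fun U => ?_)
  rw [norm_mul, norm_norm, RCLike.norm_natCast]
  exact mul_le_mul (Nat.cast_le.2 (hNb U)) (hCd U) (norm_nonneg _) (Nat.cast_nonneg _)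

/-- **The defective signed mass is at most the defect number, the clean signed mass is at least the
total mass minus the defect number.** For a bounded measurable count `N` on whose zero set (the clean
event) the determinant equals its modulus: `‖∫ det D dμ − ∫ 1_{N=0} det D dμ‖ ≤ ∫ N |det D| dμ`
(`N ≥ 1` off the clean event) and `∫ |det D| dμ − ∫ N |det D| dμ ≤ ‖∫ 1_{N=0} det D dμ‖`. -/
theorem clean_mass_bounds {Nf L : ℕ} [NeZero L] (μ : Measure (GaugeConfig 4 L SU3)) [IsFiniteMeasure μ]
    (mq : Fin Nf → ℝ) {Nn : GaugeConfig 4 L SU3 → ℕ} (hNm : Measurable Nn) {M : ℕ} (hNb : ∀ U, Nn U ≤ M)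
    (hpos : ∀ U, Nn U = 0 → (diracMatrix U mq).det = ↑‖(diracMatrix U mq).det‖) :
    ‖(∫ U, (diracMatrix U mq).det ∂μ) - ∫ U, (if Nn U = 0 then (1 : ℂ) else 0) * (diracMatrix U mq).det ∂μ‖ ≤
        ∫ U, (Nn U : ℝ) * ‖(diracMatrix U mq).det‖ ∂μ ∧
      (∫ U, ‖(diracMatrix U mq).det‖ ∂μ) - ∫ U, (Nn U : ℝ) * ‖(diracMatrix U mq).det‖ ∂μ ≤
        ‖∫ U, (if Nn U = 0 then (1 : ℂ) else 0) * (diracMatrix U mq).det ∂μ‖ := by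
  obtain ⟨Cd, hCd⟩ := exists_norm_det_diracMatrix_le (S := L) mq
  have hdm : Measurable fun U : GaugeConfig 4 L SU3 => (diracMatrix U mq).det :=
    (continuous_det_diracMatrix mq).measurable
  have hdet_int : Integrable (fun U => (diracMatrix U mq).det) μ :=
    Integrable.of_bound hdm.aestronglyMeasurable Cd (Eventually.of_forall hCd)
  have hN_int := integrable_natCast_mul_norm_det μ mq hNm hNb
  have hre : ∀ U, (if Nn U = 0 then (1 : ℂ) else 0) * (diracMatrix U mq).det =
      (((if Nn U = 0 then (1 : ℝ) else 0) * ‖(diracMatrix U mq).det‖ : ℝ) : ℂ) := fun U => by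
    by_cases h : Nn U = 0
    · rw [if_pos h, if_pos h, one_mul, one_mul]; exact hpos U h
    · rw [if_neg h, if_neg h, zero_mul, zero_mul, Complex.ofReal_zero]
  have hindr : Measurable fun U : GaugeConfig 4 L SU3 => (if Nn U = 0 then (1 : ℝ) else 0) :=
    Measurable.ite (hNm (measurableSet_singleton 0)) measurable_const measurable_const
  have hindr_int : Integrable (fun U => (if Nn U = 0 then (1 : ℝ) else 0) * ‖(diracMatrix U mq).det‖) μ := by
    refine Integrable.of_bound (hindr.mul hdm.norm).aestronglyMeasurable Cd (Eventually.of_forall fun U => ?_)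
    rw [norm_mul, norm_norm]
    exact (mul_le_of_le_one_left (norm_nonneg _) (by split_ifs <;> simp)).trans (hCd U)
  have hfun : (fun U => (if Nn U = 0 then (1 : ℂ) else 0) * (diracMatrix U mq).det) =
      fun U => ((((if Nn U = 0 then (1 : ℝ) else 0) * ‖(diracMatrix U mq).det‖ : ℝ)) : ℂ) := funext hre
  have hind_int : Integrable (fun U => (if Nn U = 0 then (1 : ℂ) else 0) * (diracMatrix U mq).det) μ :=
    hfun ▸ hindr_int.ofReal
  have h1 : ∀ U, Nn U ≠ 0 → (1 : ℝ) ≤ Nn U := fun U h => by exact_mod_cast Nat.one_le_iff_ne_zero.2 h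
  refine ⟨?_, ?_⟩
  · rw [← integral_sub hdet_int hind_int]
    refine (norm_integral_le_integral_norm _).trans
      (integral_mono (hdet_int.sub hind_int).norm hN_int fun U => ?_)
    dsimp only
    by_cases h : Nn U = 0
    · simp [h]
    · rw [if_neg h, zero_mul, sub_zero]
      nlinarith [norm_nonneg ((diracMatrix U mq).det), h1 U h]
  · rw [hfun, integral_complex_ofReal, Complex.norm_real, Real.norm_eq_abs]
    refine le_trans ?_ (le_abs_self _)
    rw [← integral_sub (integrable_norm_det_diracMatrix mq μ) hN_int]
    refine integral_mono ((integrable_norm_det_diracMatrix mq μ).sub hN_int) hindr_int fun U => ?_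
    dsimp only
    by_cases h : Nn U = 0
    · simp [h]
    · rw [if_neg h, zero_mul]
      nlinarith [norm_nonneg ((diracMatrix U mq).det), h1 U h]

/-- **Quotient perturbation.** Honest `Nu/D` versus clean `Nuc/Dc`: if the denominators differ by at
most `B`, the clean denominator has modulus `≥ Z − B`, the numerators differ by at most `C B`, and
`B ≤ ε Z`, `ε ≤ 1/4`, then `‖Nu/D − Nuc/Dc‖ ≤ 2 (C + K) ε` for any `K ≥ ‖Nuc/Dc‖` (`Z = 0`: equality). -/
theorem norm_div_sub_div_le {Nu Nuc D Dc : ℂ} {Z B C K ε : ℝ}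
    (hD : ‖D - Dc‖ ≤ B) (hDc : Z - B ≤ ‖Dc‖) (hN : ‖Nu - Nuc‖ ≤ C * B) (hB : B ≤ ε * Z)
    (hε : 0 < ε) (hε4 : ε ≤ 1 / 4) (hC : 0 ≤ C) (hK0 : 0 ≤ K) (hK : ‖Nuc / Dc‖ ≤ K) :
    ‖Nu / D - Nuc / Dc‖ ≤ 2 * (C + K) * ε := by
  have hB0 : 0 ≤ B := (norm_nonneg _).trans hD
  rcases le_or_gt Z 0 with hZ | hZ
  · have hB' : B = 0 := le_antisymm (hB.trans (mul_nonpos_of_nonneg_of_nonpos hε.le hZ)) hB0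
    have h1 : D = Dc := by
      rw [← sub_eq_zero, ← norm_le_zero_iff]; simpa [hB'] using hD
    have h2 : Nu = Nuc := by
      rw [← sub_eq_zero, ← norm_le_zero_iff]; simpa [hB'] using hN
    rw [h1, h2, sub_self, norm_zero]
    positivity
  · have hDc0 : 0 < ‖Dc‖ := by nlinarith
    have hDn : Z / 2 ≤ ‖D‖ := by
      have h1 : ‖Dc‖ - ‖D‖ ≤ ‖D - Dc‖ := by rw [norm_sub_rev]; exact norm_sub_norm_le Dc D
      nlinarith
    have hD0 : 0 < ‖D‖ := by linarith
    have hDne : D ≠ 0 := norm_pos_iff.1 hD0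
    have hDcne : Dc ≠ 0 := norm_pos_iff.1 hDc0
    have key : Nu / D - Nuc / Dc = ((Nu - Nuc) + Nuc / Dc * (Dc - D)) / D := by field_simp; ring
    rw [key, norm_div, div_le_iff₀ hD0]
    calc ‖(Nu - Nuc) + Nuc / Dc * (Dc - D)‖
        ≤ ‖Nu - Nuc‖ + ‖Nuc / Dc‖ * ‖Dc - D‖ := (norm_add_le _ _).trans (by rw [norm_mul])
      _ ≤ C * B + K * B := by
          refine add_le_add hN (mul_le_mul hK (by rwa [norm_sub_rev]) (norm_nonneg _) hK0)
      _ = (C + K) * B := by ring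
      _ ≤ (C + K) * (ε * Z) := mul_le_mul_of_nonneg_left hB (by positivity)
      _ ≤ 2 * (C + K) * ε * ‖D‖ := by nlinarith [mul_nonneg (add_nonneg hC hK0) hε.le]

/-- **The per-step estimate.** On one torus (finite measure `μ`, masses `mq`, arbitrary numerator
functional `F`, bounded measurable count `N` on whose zero set the Wilson determinant equals its
modulus): if the defect mass is `≤ ε ∫|det D| dμ` (`ε ≤ 1/4`), the defective numerator is
`≤ C ∫N|det D| dμ` and the clean quotient has modulus `≤ K`, then the honest quotient is within
`2 (C + K) ε` of the clean one (`∫dψ̄dψ e^{−ψ̄Dψ} = ± det D`, `fermiIntegral_fermiBoltzmann`). -/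
theorem norm_ratio_sub_cleanRatio_le {Nf L : ℕ} [NeZero L] (μ : Measure (GaugeConfig 4 L SU3))
    [IsFiniteMeasure μ] (mq : Fin Nf → ℝ) (F : GaugeConfig 4 L SU3 → ℂ) {Nn : GaugeConfig 4 L SU3 → ℕ}
    (hNm : Measurable Nn) {M : ℕ} (hNb : ∀ U, Nn U ≤ M)
    (hpos : ∀ U, Nn U = 0 → (diracMatrix U mq).det = ↑‖(diracMatrix U mq).det‖)
    {ε C K : ℝ} (hε : 0 < ε) (hε4 : ε ≤ 1 / 4) (hC0 : 0 ≤ C) (hK0 : 0 ≤ K)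
    (hrare : ∫ U, (Nn U : ℝ) * ‖(diracMatrix U mq).det‖ ∂μ ≤ ε * ∫ U, ‖(diracMatrix U mq).det‖ ∂μ)
    (hCB : ‖(∫ U, F U ∂μ) - ∫ U, (if Nn U = 0 then (1 : ℂ) else 0) * F U ∂μ‖ ≤
      C * ∫ U, (Nn U : ℝ) * ‖(diracMatrix U mq).det‖ ∂μ)
    (hK : ‖(∫ U, (if Nn U = 0 then (1 : ℂ) else 0) * F U ∂μ) /
        ∫ U, (if Nn U = 0 then (1 : ℂ) else 0) * fermiIntegral (fermiBoltzmann U mq) ∂μ‖ ≤ K) :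
    ‖(∫ U, F U ∂μ) / (∫ U, fermiIntegral (fermiBoltzmann U mq) ∂μ) -
        (∫ U, (if Nn U = 0 then (1 : ℂ) else 0) * F U ∂μ) /
          ∫ U, (if Nn U = 0 then (1 : ℂ) else 0) * fermiIntegral (fermiBoltzmann U mq) ∂μ‖ ≤
      2 * (C + K) * ε := by
  set es : ℂ := (-1 : ℂ) ^ (Fintype.card (FermiIdx Nf L) * (Fintype.card (FermiIdx Nf L) - 1) / 2 +
    Fintype.card (FermiIdx Nf L)) with hes
  have hes1 : ‖es‖ = 1 := by rw [hes, norm_pow, norm_neg, norm_one, one_pow]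
  have hG : (fun U : GaugeConfig 4 L SU3 => fermiIntegral (fermiBoltzmann U mq)) =
      fun U => es * (diracMatrix U mq).det :=
    funext fun U => fermiIntegral_fermiBoltzmann U mq
  have hGc : (fun U : GaugeConfig 4 L SU3 => (if Nn U = 0 then (1 : ℂ) else 0) * fermiIntegral (fermiBoltzmann U mq)) =
      fun U => es * ((if Nn U = 0 then (1 : ℂ) else 0) * (diracMatrix U mq).det) :=
    funext fun U => by rw [fermiIntegral_fermiBoltzmann, mul_left_comm]
  obtain ⟨h1, h2⟩ := clean_mass_bounds μ mq hNm hNb hpos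
  rw [hGc, integral_const_mul] at hK
  rw [hG, hGc, integral_const_mul, integral_const_mul]
  refine norm_div_sub_div_le ?_ ?_ hCB hrare hε hε4 hC0 hK0 hK
  · rwa [← mul_sub, norm_mul, hes1, one_mul]
  · rwa [norm_mul, hes1, one_mul]

/-- **Honest = clean + o(1) along a scheme with rare defects (abstract form).** Along any scheme, for
arbitrary numerator functionals `F k` and bounded measurable counts `N k` on whose zero sets the Wilson
determinant equals its modulus: if the defect mass `∫ N_k |det D| dμ_W` is `o(∫ |det D| dμ_W)`, the
defective numerators are `O(∫ N_k |det D| dμ_W)` and the clean quotients tend to `w`, so do the honest ones. -/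
theorem tendsto_ratio_of_rareDefects {Nf : ℕ} (sch : QCDScheme Nf)
    (F : ∀ k, GaugeConfig 4 (sch.side k) SU3 → ℂ) (Nn : ∀ k, GaugeConfig 4 (sch.side k) SU3 → ℕ) (w : ℂ)
    (hNm : ∀ k, Measurable (Nn k)) (hNb : ∀ k, ∃ M : ℕ, ∀ U, Nn k U ≤ M)
    (hpos : ∀ k U, Nn k U = 0 →
      (diracMatrix U fun fl => sch.mq fl k).det = ↑‖(diracMatrix U fun fl => sch.mq fl k).det‖)
    (hrare : ∀ ε : ℝ, 0 < ε → ∀ᶠ k in atTop,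
      ∫ U, (Nn k U : ℝ) * ‖(diracMatrix U fun fl => sch.mq fl k).det‖ ∂(qcdGaugeMeasure sch k) ≤
        ε * ∫ U, ‖(diracMatrix U fun fl => sch.mq fl k).det‖ ∂(qcdGaugeMeasure sch k))
    (hC : ∃ C : ℝ, ∀ᶠ k in atTop,
      ‖(∫ U, F k U ∂(qcdGaugeMeasure sch k)) -
          ∫ U, (if Nn k U = 0 then (1 : ℂ) else 0) * F k U ∂(qcdGaugeMeasure sch k)‖ ≤
        C * ∫ U, (Nn k U : ℝ) * ‖(diracMatrix U fun fl => sch.mq fl k).det‖ ∂(qcdGaugeMeasure sch k))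
    (hcl : Tendsto (fun k => (∫ U, (if Nn k U = 0 then (1 : ℂ) else 0) * F k U ∂(qcdGaugeMeasure sch k)) /
      ∫ U, (if Nn k U = 0 then (1 : ℂ) else 0) * fermiIntegral (fermiBoltzmann U fun fl => sch.mq fl k)
        ∂(qcdGaugeMeasure sch k)) atTop (𝓝 w)) :
    Tendsto (fun k => (∫ U, F k U ∂(qcdGaugeMeasure sch k)) /
      ∫ U, fermiIntegral (fermiBoltzmann U fun fl => sch.mq fl k) ∂(qcdGaugeMeasure sch k)) atTop (𝓝 w) := by
  obtain ⟨C, hC⟩ := hC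
  set clean : ℕ → ℂ := fun k =>
    (∫ U, (if Nn k U = 0 then (1 : ℂ) else 0) * F k U ∂(qcdGaugeMeasure sch k)) /
      ∫ U, (if Nn k U = 0 then (1 : ℂ) else 0) * fermiIntegral (fermiBoltzmann U fun fl => sch.mq fl k)
        ∂(qcdGaugeMeasure sch k) with hclean_def
  set honest : ℕ → ℂ := fun k => (∫ U, F k U ∂(qcdGaugeMeasure sch k)) /
      ∫ U, fermiIntegral (fermiBoltzmann U fun fl => sch.mq fl k) ∂(qcdGaugeMeasure sch k) with hhonest_def
  -- the clean quotients are eventually bounded by `‖w‖ + 1`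
  have hKev : ∀ᶠ k in atTop, ‖clean k‖ ≤ ‖w‖ + 1 := by
    filter_upwards [Metric.tendsto_nhds.1 hcl 1 one_pos] with k hk
    rw [dist_eq_norm] at hk
    linarith [norm_sub_norm_le (clean k) w]
  -- the key estimate
  have key : ∀ δ : ℝ, 0 < δ → ∀ᶠ k in atTop, ‖honest k - clean k‖ ≤ δ / 2 := by
    intro δ hδ
    have hC'0 : 0 ≤ max C 0 := le_max_right _ _
    have hK0 : 0 ≤ ‖w‖ + 1 := by positivity
    have hA : 0 < max C 0 + (‖w‖ + 1) := by positivity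
    set ε : ℝ := min (1 / 4) (δ / (4 * (max C 0 + (‖w‖ + 1)))) with hεdef
    have hε : 0 < ε := lt_min (by norm_num) (by positivity)
    have hεδ : 2 * (max C 0 + (‖w‖ + 1)) * ε ≤ δ / 2 :=
      calc 2 * (max C 0 + (‖w‖ + 1)) * ε
          ≤ 2 * (max C 0 + (‖w‖ + 1)) * (δ / (4 * (max C 0 + (‖w‖ + 1)))) :=
            mul_le_mul_of_nonneg_left (min_le_right _ _) (by positivity)
        _ = δ / 2 := by field_simp; ring
    filter_upwards [hC, hrare ε hε, hKev] with k hCk hRk hKk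
    obtain ⟨M, hM⟩ := hNb k
    haveI : IsProbabilityMeasure (qcdGaugeMeasure sch k) := isProbabilityMeasure_wilsonMeasure_fundamental _
    have hCk' : ‖(∫ U, F k U ∂(qcdGaugeMeasure sch k)) -
        ∫ U, (if Nn k U = 0 then (1 : ℂ) else 0) * F k U ∂(qcdGaugeMeasure sch k)‖ ≤
        max C 0 * ∫ U, (Nn k U : ℝ) * ‖(diracMatrix U fun fl => sch.mq fl k).det‖ ∂(qcdGaugeMeasure sch k) :=
      hCk.trans (mul_le_mul_of_nonneg_right (le_max_left _ _) (integral_nonneg fun U => by positivity))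
    exact (norm_ratio_sub_cleanRatio_le (qcdGaugeMeasure sch k) (fun fl => sch.mq fl k) (F k) (hNm k) hM
      (hpos k) hε (min_le_left _ _) hC'0 hK0 hRk hCk' hKk).trans hεδ
  -- conclusion: `honest = (honest - clean) + clean → 0 + w`
  have hdiff : Tendsto (fun k => honest k - clean k) atTop (𝓝 0) := Metric.tendsto_nhds.2 fun δ hδ =>
    (key δ hδ).mono fun k hk => by rw [dist_zero_right]; linarith
  simpa only [zero_add, sub_add_cancel] using hdiff.add hcl

/-- `B/Z ≤ ε`, `B ≤ M Z` and `Z ≥ 0` give `B ≤ ε Z` (the junk case `Z = 0` included). -/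
theorem le_mul_of_div_le_of_le_mul {B Z M ε : ℝ} (h : B / Z ≤ ε) (hB : B ≤ M * Z) (hZ : 0 ≤ Z) :
    B ≤ ε * Z := by
  rcases hZ.eq_or_lt with rfl | hZ
  · simpa using hB
  · exact (div_le_iff₀ hZ).1 h

/-- **EXTINCT at the scheme's own side.** Along `reg.scheme m z shift` (side `2L_k+1`, volume factor
`((2L_k+1)/(2L_k+1))⁴ = 1`), EXTINCT gives `∫ N_k |det D| dμ_W ≤ ε ∫ |det D| dμ_W` eventually, for every
`ε > 0` (`|det D| = ∏_f |det D_W(m_f(k))|`; `N_k` is bounded, which settles the case `∫|det D| = 0`). -/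
theorem eventually_defectMass_le {Nf : ℕ} (reg : QCDRegularisation Nf) (c : ℝ) (m : Fin Nf → ℝ)
    (z shift : QCDField Nf → ℕ → ℝ) (hE : Extinct Nf reg c m) {ε : ℝ} (hε : 0 < ε) :
    ∀ᶠ k : ℕ in atTop,
      ∫ U, (((∑ g : Fin Nf, (Multiset.countP (fun z : ℂ => z.im = 0 ∧ z.re < -(reg.mcrit k + reg.a k * m g / reg.Zm k)) (wilsonDirac (fundamentalRep (Fin 3)) U 0 1).charpoly.roots + Multiset.countP (fun z : ℂ => |z.re| < c * (reg.a k * m g / reg.Zm k)) (spinorLift gammaFive * wilsonDirac (fundamentalRep (Fin 3)) U (reg.mcrit k + reg.a k * m g / reg.Zm k) 1).charpoly.roots)) : ℕ) : ℝ) * ‖(diracMatrix U fun fl => (reg.scheme m z shift).mq fl k).det‖ ∂(qcdGaugeMeasure (reg.scheme m z shift) k) ≤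
        ε * ∫ U, ‖(diracMatrix U fun fl => (reg.scheme m z shift).mq fl k).det‖ ∂(qcdGaugeMeasure (reg.scheme m z shift) k) := by
  filter_upwards [hE ε hε] with k hk
  have hk1 := hk (reg.L k) le_rfl
  rw [div_self (show (2 * (reg.L k : ℝ) + 1) ≠ 0 by positivity), one_pow, mul_one] at hk1
  have hX : ∀ U : GaugeConfig 4 (2 * reg.L k + 1) SU3,
      (∑ f : Fin Nf, ((Multiset.countP (fun z : ℂ => z.im = 0 ∧ z.re < -(reg.mcrit k + reg.a k * m f / reg.Zm k)) (wilsonDirac (fundamentalRep (Fin 3)) U 0 1).charpoly.roots : ℝ) + (Multiset.countP (fun z : ℂ => |z.re| < c * (reg.a k * m f / reg.Zm k)) (spinorLift gammaFive * wilsonDirac (fundamentalRep (Fin 3)) U (reg.mcrit k + reg.a k * m f / reg.Zm k) 1).charpoly.roots : ℝ))) =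
        (((∑ g : Fin Nf, (Multiset.countP (fun z : ℂ => z.im = 0 ∧ z.re < -(reg.mcrit k + reg.a k * m g / reg.Zm k)) (wilsonDirac (fundamentalRep (Fin 3)) U 0 1).charpoly.roots + Multiset.countP (fun z : ℂ => |z.re| < c * (reg.a k * m g / reg.Zm k)) (spinorLift gammaFive * wilsonDirac (fundamentalRep (Fin 3)) U (reg.mcrit k + reg.a k * m g / reg.Zm k) 1).charpoly.roots)) : ℕ) : ℝ) := fun U => by
    push_cast
    rfl
  have hW : ∀ U : GaugeConfig 4 (2 * reg.L k + 1) SU3,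
      (∏ f : Fin Nf, ‖fermionDet (wilsonDirac (fundamentalRep (Fin 3)) U (reg.mcrit k + reg.a k * m f / reg.Zm k) 1)‖) =
        ‖(diracMatrix U fun fl => reg.mcrit k + reg.a k * m fl / reg.Zm k).det‖ := fun U => by
    rw [norm_det_diracMatrix]
  simp_rw [hX, hW] at hk1
  have hNle : ∀ U : GaugeConfig 4 (2 * reg.L k + 1) SU3,
      (∑ g : Fin Nf, (Multiset.countP (fun z : ℂ => z.im = 0 ∧ z.re < -(reg.mcrit k + reg.a k * m g / reg.Zm k)) (wilsonDirac (fundamentalRep (Fin 3)) U 0 1).charpoly.roots + Multiset.countP (fun z : ℂ => |z.re| < c * (reg.a k * m g / reg.Zm k)) (spinorLift gammaFive * wilsonDirac (fundamentalRep (Fin 3)) U (reg.mcrit k + reg.a k * m g / reg.Zm k) 1).charpoly.roots)) ≤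
        ∑ _g : Fin Nf, (Fintype.card (QuarkIdx (2 * reg.L k + 1)) + Fintype.card (QuarkIdx (2 * reg.L k + 1))) :=
    fun U => Finset.sum_le_sum fun g _ =>
      add_le_add (countP_roots_charpoly_le_card _ _) (countP_roots_charpoly_le_card _ _)
  have hNm : Measurable fun U : GaugeConfig 4 (2 * reg.L k + 1) SU3 =>
      ∑ g : Fin Nf, (Multiset.countP (fun z : ℂ => z.im = 0 ∧ z.re < -(reg.mcrit k + reg.a k * m g / reg.Zm k)) (wilsonDirac (fundamentalRep (Fin 3)) U 0 1).charpoly.roots + Multiset.countP (fun z : ℂ => |z.re| < c * (reg.a k * m g / reg.Zm k)) (spinorLift gammaFive * wilsonDirac (fundamentalRep (Fin 3)) U (reg.mcrit k + reg.a k * m g / reg.Zm k) 1).charpoly.roots) :=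
    Finset.measurable_sum _ fun g _ => (measurable_signDefectCount _).add (measurable_coercivityDefectCount _ _)
  have hBM := integral_mono
    (integrable_natCast_mul_norm_det (wilsonMeasure (d := 4) (L := 2 * reg.L k + 1) (fundamentalRep (Fin 3)) (reg.β k))
      (fun fl => reg.mcrit k + reg.a k * m fl / reg.Zm k) hNm hNle)
    ((integrable_norm_det_diracMatrix (fun fl => reg.mcrit k + reg.a k * m fl / reg.Zm k)
      (wilsonMeasure (d := 4) (L := 2 * reg.L k + 1) (fundamentalRep (Fin 3)) (reg.β k))).const_mul
      ((∑ _g : Fin Nf, (Fintype.card (QuarkIdx (2 * reg.L k + 1)) + Fintype.card (QuarkIdx (2 * reg.L k + 1))) : ℕ) : ℝ))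
    fun U => mul_le_mul_of_nonneg_right (Nat.cast_le.2 (hNle U)) (norm_nonneg _)
  rw [integral_const_mul] at hBM
  exact le_mul_of_div_le_of_le_mul hk1 hBM (integral_nonneg fun _ => norm_nonneg _)

/-- `stub_schemeVolumeTransfer` — **the exchange identity made exact: honest = clean + o(1) at the
scheme's own side, NO extinction rate.** Along `reg` with EXTINCT, positive coercivity fraction `c` and
positive renormalised masses `m`, for every insertion string: if the defective part of the honest
numerator is bounded by `C ∫ N_k |det D| dμ_W` eventually (conditional defect regularity) and the clean
sub-ensemble Schwinger function tends to `w`, then the honest lattice Schwinger function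
`qcdLatticeSchwinger (reg.scheme m z shift) k n σ f` tends to `w` (`det D > 0` on the clean event,
`det_diracMatrix_eq_norm_of_clean`; EXTINCT at `S = L_k`, `eventually_defectMass_le`; quotient algebra,
`tendsto_ratio_of_rareDefects`; the junk case `∫|det D| dμ_W = 0` is exact equality of the quotients). -/
theorem stub_schemeVolumeTransfer :
    ∀ (Nf : ℕ) (reg : QCDRegularisation Nf) (c : ℝ) (m : Fin Nf → ℝ) (z shift : QCDField Nf → ℕ → ℝ)
      (n : ℕ) (σ : Fin n → QCDField Nf) (f : Fin n → 𝓢(EuclideanSpace ℝ (Fin 4), ℝ)) (w : ℂ),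
      0 < c → (∀ fl, 0 < m fl) → Extinct Nf reg c m →
        (∃ C : ℝ, ∀ᶠ k : ℕ in atTop, ‖(∫ U, fermiIntegral ((List.ofFn fun i => smearedInsertion (reg.scheme m z shift) k U (σ i) (f i)).prod * fermiBoltzmann U fun fl => (reg.scheme m z shift).mq fl k) ∂(qcdGaugeMeasure (reg.scheme m z shift) k)) - ∫ U, (if (∑ g : Fin Nf, (Multiset.countP (fun z : ℂ => z.im = 0 ∧ z.re < -(reg.mcrit k + reg.a k * m g / reg.Zm k)) (wilsonDirac (fundamentalRep (Fin 3)) U 0 1).charpoly.roots + Multiset.countP (fun z : ℂ => |z.re| < c * (reg.a k * m g / reg.Zm k)) (spinorLift gammaFive * wilsonDirac (fundamentalRep (Fin 3)) U (reg.mcrit k + reg.a k * m g / reg.Zm k) 1).charpoly.roots)) = 0 then (1 : ℂ) else 0) * fermiIntegral ((List.ofFn fun i => smearedInsertion (reg.scheme m z shift) k U (σ i) (f i)).prod * fermiBoltzmann U fun fl => (reg.scheme m z shift).mq fl k) ∂(qcdGaugeMeasure (reg.scheme m z shift) k)‖ ≤ C * ∫ U, (((∑ g : Fin Nf, (Multiset.countP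 (fun z : ℂ => z.im = 0 ∧ z.re < -(reg.mcrit k + reg.a k * m g / reg.Zm k)) (wilsonDirac (fundamentalRep (Fin 3)) U 0 1).charpoly.roots + Multiset.countP (fun z : ℂ => |z.re| < c * (reg.a k * m g / reg.Zm k)) (spinorLift gammaFive * wilsonDirac (fundamentalRep (Fin 3)) U (reg.mcrit k + reg.a k * m g / reg.Zm k) 1).charpoly.roots)) : ℕ) : ℝ) * ‖(diracMatrix U fun fl => (reg.scheme m z shift).mq fl k).det‖ ∂(qcdGaugeMeasure (reg.scheme m z shift) k)) →
        Tendsto (fun k : ℕ => (∫ U, (if (∑ g : Fin Nf, (Multiset.countP (fun z : ℂ => z.im = 0 ∧ z.re < -(reg.mcrit k + reg.a k * m g / reg.Zm k)) (wilsonDirac (fundamentalRep (Fin 3)) U 0 1).charpoly.roots + Multiset.countP (fun z : ℂ => |z.re| < c * (reg.a k * m g / reg.Zm k)) (spinorLift gammaFive * wilsonDirac (fundamentalRep (Fin 3)) U (reg.mcrit k + reg.a k * m g / reg.Zm k) 1).charpoly.roots)) = 0 then (1 : ℂ) else 0) * fermiIntegral ((List.ofFn fun i => smearedInsertion (reg.scheme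 m z shift) k U (σ i) (f i)).prod * fermiBoltzmann U fun fl => (reg.scheme m z shift).mq fl k) ∂(qcdGaugeMeasure (reg.scheme m z shift) k)) / ∫ U, (if (∑ g : Fin Nf, (Multiset.countP (fun z : ℂ => z.im = 0 ∧ z.re < -(reg.mcrit k + reg.a k * m g / reg.Zm k)) (wilsonDirac (fundamentalRep (Fin 3)) U 0 1).charpoly.roots + Multiset.countP (fun z : ℂ => |z.re| < c * (reg.a k * m g / reg.Zm k)) (spinorLift gammaFive * wilsonDirac (fundamentalRep (Fin 3)) U (reg.mcrit k + reg.a k * m g / reg.Zm k) 1).charpoly.roots)) = 0 then (1 : ℂ) else 0) * fermiIntegral (fermiBoltzmann U fun fl => (reg.scheme m z shift).mq fl k) ∂(qcdGaugeMeasure (reg.scheme m z shift) k)) atTop (𝓝 w) →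
          Tendsto (fun k : ℕ => qcdLatticeSchwinger (reg.scheme m z shift) k n σ f) atTop (𝓝 w) := by
  intro Nf reg c m z shift n σ f w hc hm hE hC hcl
  refine tendsto_ratio_of_rareDefects (reg.scheme m z shift)
    (fun k U => fermiIntegral ((List.ofFn fun i => smearedInsertion (reg.scheme m z shift) k U (σ i) (f i)).prod *
      fermiBoltzmann U fun fl => (reg.scheme m z shift).mq fl k))
    (fun k U => (∑ g : Fin Nf, (Multiset.countP (fun z : ℂ => z.im = 0 ∧ z.re < -(reg.mcrit k + reg.a k * m g / reg.Zm k)) (wilsonDirac (fundamentalRep (Fin 3)) U 0 1).charpoly.roots + Multiset.countP (fun z : ℂ => |z.re| < c * (reg.a k * m g / reg.Zm k)) (spinorLift gammaFive * wilsonDirac (fundamentalRep (Fin 3)) U (reg.mcrit k + reg.a k * m g / reg.Zm k) 1).charpoly.roots)))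
    w ?_ ?_ ?_ ?_ ?_ ?_
  · exact fun k => Finset.measurable_sum _ fun g _ =>
      (measurable_signDefectCount _).add (measurable_coercivityDefectCount _ _)
  · exact fun k => ⟨∑ _g : Fin Nf, (Fintype.card (QuarkIdx ((reg.scheme m z shift).side k)) +
        Fintype.card (QuarkIdx ((reg.scheme m z shift).side k))),
      fun U => Finset.sum_le_sum fun g _ =>
        add_le_add (countP_roots_charpoly_le_card _ _) (countP_roots_charpoly_le_card _ _)⟩
  · exact fun k U hU => det_diracMatrix_eq_norm_of_clean reg hc hm k U hU
  · exact fun ε hε => eventually_defectMass_le reg c m z shift hE hε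
  · exact hC
  · exact hcl

end Summit.QuantumFields.QCD.Cruxes.ExtinctionBuildsQCD.DilutionBuysLocalRarity

end
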